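import Mathlib
import HarnessLib

/-!
# "Agreement AT EVERY β": the Bonferroni calibration of a whole A-versus-B table — `k` columns
# each agreeing with (asymptotic) probability `c_j` agree SIMULTANEOUSLY with probability at
# least `1 − Σ_j (1 − c_j)` (finite-sample and asymptotic forms)

HONEST FRAMING: exact (Metropolis-corrected) sampling algorithms for lattice gauge theory;
figures of merit are autocorrelation/cost numbers at stated couplings and volumes; no
continuum-physics claim.

Venture `LatticeQCDFlow` (cell pub-lqcd), topic `Scoring`; FANOUT row 4 (`s0-u1-b`, rung S0-B).
The A-versus-B table asks for agreement of the two codes "at every `β`" — seven couplings, several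
columns each.  Column by column the cell's theorems give the asymptotic probability of the
criterion (`Scoring/AsymptoticCoverage.twoSample_agreement_coverage`: `→ N(0,1)([−z, z])`); the
table-level sentence needs the elementary union bound, stated here once for abstract events on
one probability space (the joint space of all runs — no independence between columns or
couplings is needed or used): **Bonferroni's inequality**
`1 − Σ_{j∈s}(1 − P(E_j)) ≤ P(⋂_{j∈s} E_j)` (**`one_sub_sum_le_measureReal_biInter`**), its
asymptotic form — if `P(Eₙ^j) → c_j` for each of finitely many columns `j` then for every `ε > 0`
eventually `P(⋂_j Eₙ^j) ≥ 1 − Σ_j (1 − c_j) − ε` (**`eventually_measureReal_biInter_ge`**) — and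
the equal-level case `1 − k(1 − c) − ε` (**`eventually_measureReal_biInter_ge_const`**): with
per-column level `c = 1 − α/k` the whole table agrees with asymptotic probability `≥ 1 − α − ε`.
NEW WORK of the cell (textbook; our formalisation); no definition; nothing cited as a fact.

## Content

* **`one_sub_sum_le_measureReal_biInter`** — Bonferroni (finite sample, measurable events);
* **`eventually_measureReal_biInter_ge`**, **`eventually_measureReal_biInter_ge_const`**.

NOT CLAIMED: sharper simultaneous calibrations using the dependence structure (e.g. a joint
Gaussian limit of all columns); anything about which `z` the card uses.
-/

noncomputable section

namespace Summit.Ventures.LatticeQCDFlow.Scoring.CardConsistency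

open MeasureTheory Filter Finset
open scoped Topology

variable {Ω : Type*} [MeasurableSpace Ω] {P : Measure Ω} [IsProbabilityMeasure P]
variable {ι : Type*}

/-- **BONFERRONI'S INEQUALITY.**  Finitely many measurable events `E_j`, `j ∈ s`, of a probability
space: `1 − Σ_{j∈s} (1 − P(E_j)) ≤ P(⋂_{j∈s} E_j)`. [textbook] -/
theorem one_sub_sum_le_measureReal_biInter (s : Finset ι) {E : ι → Set Ω}
    (hE : ∀ j ∈ s, MeasurableSet (E j)) :
    1 - ∑ j ∈ s, (1 - P.real (E j)) ≤ P.real (⋂ j ∈ s, E j) := by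
  have hI : MeasurableSet (⋂ j ∈ s, E j) := s.measurableSet_biInter hE
  have hcompl : P.real (⋂ j ∈ s, E j) = 1 - P.real (⋃ j ∈ s, (E j)ᶜ) := by
    rw [← Set.compl_iInter₂, probReal_compl_eq_one_sub hI]
    ring
  have hU : P.real (⋃ j ∈ s, (E j)ᶜ) ≤ ∑ j ∈ s, P.real ((E j)ᶜ) :=
    measureReal_biUnion_finset_le s _
  have hsum : ∑ j ∈ s, P.real ((E j)ᶜ) = ∑ j ∈ s, (1 - P.real (E j)) :=
    Finset.sum_congr rfl fun j hj => probReal_compl_eq_one_sub (hE j hj)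
  rw [hcompl]
  linarith

/-- **ASYMPTOTIC BONFERRONI.**  Events `Eₙ^j` (measurable) with `P(Eₙ^j) → c_j` for each of
finitely many `j ∈ s`; then for every `ε > 0`, eventually
`1 − Σ_{j∈s}(1 − c_j) − ε ≤ P(⋂_{j∈s} Eₙ^j)`. [ours] -/
theorem eventually_measureReal_biInter_ge (s : Finset ι) {E : ι → ℕ → Set Ω}
    (hE : ∀ j ∈ s, ∀ n, MeasurableSet (E j n)) {c : ι → ℝ}
    (hc : ∀ j ∈ s, Tendsto (fun n => P.real (E j n)) atTop (𝓝 (c j))) {ε : ℝ} (hε : 0 < ε) :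
    ∀ᶠ n in atTop, 1 - ∑ j ∈ s, (1 - c j) - ε ≤ P.real (⋂ j ∈ s, E j n) := by
  -- the Bonferroni lower bounds converge to `1 − Σ (1 − c_j)`
  have hb : Tendsto (fun n => 1 - ∑ j ∈ s, (1 - P.real (E j n))) atTop
      (𝓝 (1 - ∑ j ∈ s, (1 - c j))) :=
    tendsto_const_nhds.sub (tendsto_finsetSum s fun j hj => tendsto_const_nhds.sub (hc j hj))
  have hev : ∀ᶠ n in atTop, 1 - ∑ j ∈ s, (1 - c j) - ε < 1 - ∑ j ∈ s, (1 - P.real (E j n)) :=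
    hb.eventually (lt_mem_nhds (by linarith))
  filter_upwards [hev] with n hn
  exact hn.le.trans (one_sub_sum_le_measureReal_biInter s fun j hj => hE j hj n)

/-- **Equal levels**: if every column's criterion has asymptotic probability `c` (e.g.
`c = N(0,1)([−z, z])` for all `k = #s` columns), then for every `ε > 0` eventually
`1 − k(1 − c) − ε ≤ P(all columns agree)`. [ours] -/
theorem eventually_measureReal_biInter_ge_const (s : Finset ι) {E : ι → ℕ → Set Ω}
    (hE : ∀ j ∈ s, ∀ n, MeasurableSet (E j n)) {c : ℝ}
    (hc : ∀ j ∈ s, Tendsto (fun n => P.real (E j n)) atTop (𝓝 c)) {ε : ℝ} (hε : 0 < ε) :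
    ∀ᶠ n in atTop, 1 - (s.card : ℝ) * (1 - c) - ε ≤ P.real (⋂ j ∈ s, E j n) := by
  have h := eventually_measureReal_biInter_ge s hE (c := fun _ => c) hc hε
  simp only [Finset.sum_const, nsmul_eq_mul] at h
  exact h

end Summit.Ventures.LatticeQCDFlow.Scoring.CardConsistency

end
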